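import Summits.AtomisticToContinuum.BoseEinsteinCondensation.Theorems.BECConjugateDominationHardCoreExtensionNearMinTower
import Summits.AtomisticToContinuum.BoseEinsteinCondensation.Theorems.BECConjugateDominationHardCoreExtensionTowerEnergyConvergence
import Summits.AtomisticToContinuum.BoseEinsteinCondensation.Theorems.BECConjugateDominationHardCoreExtensionSmoothTowerHardCore
import Literature.Barriers.AtomisticToContinuum.KineticGapLengthScalesFreeGas
import HarnessLib

/-!
# Near-minimiser slack transfer: the SMOOTH currency for hard spheres, and non-vacuity of T★
# (crux `BECConjugateDomination.HardCoreExtension`, stmt-AtomisticToContinuum-11786 — line `near-minimiser-slack-transfer`, lead c7)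

Sequel of `…HardCoreExtensionNearMinTower.lean` (the transfer `periodicBEC_of_minorantTowerBEC`), fed with the two landed
worker stubs of the line: W-A `stub_towerEnergyConvergence` (fixed-volume energy convergence along EVERY monotone measurable
tower `wₙ ↑ v`) and W-B `stub_smoothTowerHardCore` (an explicit monotone tower of SMOOTH-CLASS potentials
`t · solidBump a ↑ hardCorePotential a`, the route's own currency: repulsive finite range, finite, `C²` as `x ↦ w(|x|)`, edge
condition, range `≤ a`).

* `periodicBEC_of_smoothTowerBEC_hardCore` — if near-minimiser periodic BEC holds along every such smooth-class tower with
  the slack uniform in the height (eventually), then near-minimiser periodic BEC of the hard-sphere gas (the hypothesis of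
  `BoundaryTransferWeak (hardCorePotential a)`);
* `diluteBEC_hardSpheres_of_smoothTowerBEC` — … hence, with the boundary transfer, `HasGroundStateBEC (hardCorePotential a) ρ`
  for all small `ρ`: hard-sphere BEC from HEIGHT-UNIFORM SMOOTH-BUMP near-minimiser BEC, i.e. from the route's target
  `SmoothPeriodicBEC` (stmt-11783) made uniform along one explicit one-parameter family;
* `nearMinimiserTowerBEC_zero` — the registered thermodynamic stub T★ of the line holds at the free gas (`c = ½`), its only
  computable member: the stub is consistent exactly where the crux's antecedent is (Disproof §1).

References: E. H. Lieb, R. Seiringer, J. P. Solovej, J. Yngvason, *The Mathematics of the Bose Gas and its Condensation*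
(2005), §1.2 (1.19), Ch. 2 (after (2.1)), Ch. 5 p. 42; M. Reed, B. Simon, *Methods of Modern Mathematical Physics IV*
(1978), Thm XIII.64.
-/

noncomputable section

namespace Summit.AtomisticToContinuum.BoseEinsteinCondensation.Cruxes.HardCoreExtension.NearMinTower

open MeasureTheory Filter
open scoped ENNReal NNReal Topology
open Literature.MathematicalPhysics.QuantumManyBody.BoseGas
open Summit.AtomisticToContinuum.BoseEinsteinCondensation.Theses.BECConjugateDomination

/-- **Near-minimiser periodic BEC of the hard-sphere gas from near-minimiser BEC along SMOOTH-CLASS towers.** If for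
every monotone smooth-class tower `w t ↑ hardCorePotential a` (range `≤ a`) near-minimiser periodic BEC holds along the
tower with the slack uniform in the height (eventually), then `PeriodicBEC(hardCorePotential a)` — by the general tower
energy convergence (W-A) along the explicit tower (W-B) and the slack transfer `periodicBEC_of_minorantTowerBEC`.
[cite: LSSY2005, Ch. 2 (after (2.1)); ReedSimonIV1978, Thm XIII.64] -/
theorem periodicBEC_of_smoothTowerBEC_hardCore :
    ∀ a : ℝ, 0 < a →
    (∀ w : ℕ → ℝ → ℝ≥0∞,
      (∀ t, IsRepulsiveFiniteRange (w t) ∧ (∀ r, w t r ≠ ⊤) ∧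
        ContDiff ℝ 2 (fun x : Space => (w t ‖x‖).toReal) ∧
        (∃ Cₑ : ℝ, ∀ x : Space,
          ‖iteratedFDeriv ℝ 2 (fun x : Space => (w t ‖x‖).toReal) x‖ ≤ Cₑ * Real.sqrt ((w t ‖x‖).toReal)) ∧
        (∀ r, a < r → w t r = 0)) →
      (∀ t r, w t r ≤ w (t + 1) r) → (∀ r, ⨆ t, w t r = hardCorePotential a r) →
      ∃ ρ₀ : ℝ, 0 < ρ₀ ∧ ∀ ρ : ℝ, 0 < ρ → ρ < ρ₀ → ∃ c : ℝ, 0 < c ∧ ∀ᶠ N : ℕ in atTop,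
        ∃ δ : ℝ≥0∞, 0 < δ ∧ ∃ t₀ : ℕ, ∀ t : ℕ, t₀ ≤ t →
          ∀ Ψ : PeriodicTrialState N (sideLength ρ N),
            periodicEnergy (w t) Ψ ≤ periodicGroundStateEnergy (w t) N (sideLength ρ N) + δ →
              ENNReal.ofReal (c * N) ≤ condensateOccupation N (sideLength ρ N) Ψ.ψ) →
    ∃ ρ₀ : ℝ, 0 < ρ₀ ∧ ∀ ρ : ℝ, 0 < ρ → ρ < ρ₀ → ∃ c : ℝ, 0 < c ∧ ∀ᶠ N : ℕ in atTop,
      ∃ δ : ℝ≥0∞, 0 < δ ∧ ∀ Ψ : PeriodicTrialState N (sideLength ρ N),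
        periodicEnergy (hardCorePotential a) Ψ ≤ periodicGroundStateEnergy (hardCorePotential a) N (sideLength ρ N) + δ →
          ENNReal.ofReal (c * N) ≤ condensateOccupation N (sideLength ρ N) Ψ.ψ := by
  intro a ha hT
  obtain ⟨w, hw, hmono, hsup⟩ := stub_smoothTowerHardCore a ha
  have hv := isRepulsiveFiniteRange_hardCorePotential a
  have hwv : ∀ t r, w t r ≤ hardCorePotential a r := fun t r => (hsup r) ▸ le_iSup (fun t => w t r) t
  exact periodicBEC_of_minorantTowerBEC _ hv w hwv
    (fun N L hL hE ε hε => stub_towerEnergyConvergence _ hv w (fun t => (hw t).1.1) hmono hsup N L hL hE ε hε)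
    (hT w hw hmono hsup)

/-- **Hard-sphere BEC from near-minimiser BEC along SMOOTH-CLASS towers** (+ the boundary transfer `BoundaryTransferWeak`,
stmt-0827, at the hard-sphere potential): `HasGroundStateBEC (hardCorePotential a) ρ` for all small `ρ`.
[cite: LSSY2005, Ch. 2 (after (2.1)) and Ch. 5 p. 42] -/
theorem diluteBEC_hardSpheres_of_smoothTowerBEC {a : ℝ} (ha : 0 < a) (hbt : BoundaryTransferWeak)
    (hT : ∀ w : ℕ → ℝ → ℝ≥0∞,
      (∀ t, IsRepulsiveFiniteRange (w t) ∧ (∀ r, w t r ≠ ⊤) ∧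
        ContDiff ℝ 2 (fun x : Space => (w t ‖x‖).toReal) ∧
        (∃ Cₑ : ℝ, ∀ x : Space,
          ‖iteratedFDeriv ℝ 2 (fun x : Space => (w t ‖x‖).toReal) x‖ ≤ Cₑ * Real.sqrt ((w t ‖x‖).toReal)) ∧
        (∀ r, a < r → w t r = 0)) →
      (∀ t r, w t r ≤ w (t + 1) r) → (∀ r, ⨆ t, w t r = hardCorePotential a r) →
      ∃ ρ₀ : ℝ, 0 < ρ₀ ∧ ∀ ρ : ℝ, 0 < ρ → ρ < ρ₀ → ∃ c : ℝ, 0 < c ∧ ∀ᶠ N : ℕ in atTop,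
        ∃ δ : ℝ≥0∞, 0 < δ ∧ ∃ t₀ : ℕ, ∀ t : ℕ, t₀ ≤ t →
          ∀ Ψ : PeriodicTrialState N (sideLength ρ N),
            periodicEnergy (w t) Ψ ≤ periodicGroundStateEnergy (w t) N (sideLength ρ N) + δ →
              ENNReal.ofReal (c * N) ≤ condensateOccupation N (sideLength ρ N) Ψ.ψ) :
    ∃ ρ₀ : ℝ, 0 < ρ₀ ∧ ∀ ρ : ℝ, 0 < ρ → ρ < ρ₀ → HasGroundStateBEC (hardCorePotential a) ρ :=
  hbt _ (isRepulsiveFiniteRange_hardCorePotential a) (periodicBEC_of_smoothTowerBEC_hardCore a ha hT)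

/-- **T★ holds at the free gas** (`v = 0`: every truncation is `0`; `c = ½`, slack `N/(2CL_N²)` — the landed
`periodicBEC_antecedent_free` through `nearMinimiserTowerBEC_iff_of_bounded`): the registered stub of the line is
consistent at its only computable member, exactly like the crux's antecedent. [cite: LSSY2005, §1.2 (1.19)] -/
theorem nearMinimiserTowerBEC_zero :
    ∃ ρ₀ : ℝ, 0 < ρ₀ ∧ ∀ ρ : ℝ, 0 < ρ → ρ < ρ₀ → ∃ c : ℝ, 0 < c ∧ ∀ᶠ N : ℕ in atTop,
        ∃ δ : ℝ≥0∞, 0 < δ ∧ ∃ n₀ : ℕ, ∀ n : ℕ, n₀ ≤ n →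
          ∀ Ψ : PeriodicTrialState N (sideLength ρ N),
            periodicEnergy (fun r => min ((0 : ℝ → ℝ≥0∞) r) (n : ℝ≥0∞)) Ψ ≤
                periodicGroundStateEnergy (fun r => min ((0 : ℝ → ℝ≥0∞) r) (n : ℝ≥0∞)) N (sideLength ρ N) + δ →
              ENNReal.ofReal (c * N) ≤ condensateOccupation N (sideLength ρ N) Ψ.ψ :=
  (nearMinimiserTowerBEC_iff_of_bounded 0 (M := 0) fun _ => by simp).2
    Literature.Barriers.AtomisticToContinuum.BoseGas.periodicBEC_antecedent_free

end Summit.AtomisticToContinuum.BoseEinsteinCondensation.Cruxes.HardCoreExtension.NearMinTower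

end
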